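import Literature.Analysis.SingularIntegrals.HardyLittlewoodMaximal
import Mathlib.MeasureTheory.Function.LpSeminorm.Basic
import Mathlib.Analysis.SpecificLimits.Basic
import HarnessLib

/-!
# The maximal function dominates approximate identities (Stein 1970, Ch. III §2.2 Theorem 2 (a))

Analysis/SingularIntegrals file, a short second layer over `HardyLittlewoodMaximal.lean` (the
Hardy–Littlewood maximal function `maximalFunction μ F` on a finite-dimensional real normed space
with Haar measure, its weak `(1,1)` and strong `(p,p)` bounds), vendored for the a.e. theory of
singular integrals (Stein 1970, Ch. II §4.5 Theorem 4 through the maximal singular integral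
`T*f ≤ M(Tf) + C·Mf`, Ch. III §2 Lemma pp. 59–60), i.e. for the discharge of the named fact
`Literature.Analysis.FluidPDE.stein1970_normalisedPressure_ae_Lp_bound`. Everything here is PROVED.

**Stein 1970, Ch. III §2.2 Theorem 2 (a).** *Suppose that the least decreasing radial majorant
of `φ` is integrable, `ψ(x) = sup_{|y| ≥ |x|} |φ(y)|`, `∫ψ = A < ∞`. Then
`sup_{ε>0} |(f * φ_ε)(x)| ≤ A·Mf(x)`.* We prove the two instances consumed by the maximal
singular integral (§2 Lemma, (20)–(22): `T_ε f = (Tf) * φ_ε - f * Φ_ε` with `φ` a bump in the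
unit ball and `|Φ(x)| ≤ A(1+|x|)^{-n-1}`):

* `setLIntegral_closedBall_le_maximalFunction_mul` — kernels supported in a ball:
  `∫_{B̄(x,r)} F ≤ MF(x) μ(B(x,r))` (the open-ball form is in `HardyLittlewoodMaximal`; the sphere
  is Haar-null);
* `lintegral_mul_decay_le_maximalFunction` — kernels with the decay `(1+|y|)^{-n-1}`:
  `∫ F(z) (1 + |x-z|/ε)^{-(n+1)} dμ(z) ≤ 2ⁿ⁺² μ(B(x,ε)) MF(x)` (dyadic shells `B(x, 2ᵏε)`,
  `μ(B(x,2ᵏε)) = 2^{kn} μ(B(x,ε))`, `Σₖ 2^{-k} = 2`; Stein's integration by parts in the radius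
  replaced by the dyadic sum, constant `2ⁿ⁺²` in place of `∫ψ`);
* `exists_eLpNorm_maximalFunction_le` — the strong type `(p,p)` of `HardyLittlewoodMaximal` in
  `eLpNorm` form for functions: `‖(M‖f‖ₑ)(·).toReal‖_{L^p} ≤ C ‖f‖_{L^p}`, `1 < p < ∞`.

## Mathlib / tree

`exists_nat_pow_near`, `ENNReal.tsum_geometric`, `lintegral_tsum`, `Measure.addHaar_sphere_of_ne_zero`,
`eLpNorm_eq_lintegral_rpow_enorm_toReal` (used); tree: `maximalFunction`,
`setLIntegral_ball_le_maximalFunction_mul`, `measure_ball_mul_eq`, `lintegral_maximalFunction_rpow_le`,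
`maximalLpConst_lt_top` (`HardyLittlewoodMaximal`, used).

## References

* E. M. Stein, *Singular integrals and differentiability properties of functions*, Princeton
  Math. Series 30 (1970): Ch. III §2.2 Theorem 2 (a) and its proof ((16)–(17), p. 57); Ch. III
  §2 Lemma (20)–(22) (pp. 59–60); Ch. I §1.3 Theorem 1 (c). [`Stein1971`]
-/

noncomputable section

open MeasureTheory Metric Set Filter Function Topology
open scoped ENNReal NNReal

namespace Literature.Analysis.SingularIntegrals

universe u

variable {E : Type u} [NormedAddCommGroup E] [NormedSpace ℝ E] [FiniteDimensional ℝ E]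
  [MeasurableSpace E] [BorelSpace E] (μ : Measure E) [μ.IsAddHaarMeasure]

/-! ### Kernels supported in a ball -/

/-- Closed and open balls of positive radius agree up to a Haar-null set. [folklore] -/
theorem closedBall_ae_eq_ball_haar (x : E) {r : ℝ} (hr : 0 < r) : closedBall x r =ᵐ[μ] ball x r := by
  refine ae_eq_set.2 ⟨?_, by rw [sdiff_eq_bot_iff.mpr ball_subset_closedBall]; exact measure_empty⟩
  have hsub : closedBall x r \ ball x r ⊆ sphere x r := fun y hy =>
    mem_sphere.2 (le_antisymm (mem_closedBall.1 hy.1) (not_lt.1 fun h => hy.2 (mem_ball.2 h)))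
  exact measure_mono_null hsub (Measure.addHaar_sphere_of_ne_zero μ x hr.ne')

/-- **Domination for kernels supported in a ball, closed-ball form** (Stein 1970, Ch. III §2.2
Theorem 2 (a) with `φ = 1_B/m(B)`): `∫_{B̄(x,r)} F ≤ MF(x) μ(B(x,r))`. [cite: Stein1971, Ch. III §2.2 Thm 2 (a)] -/
theorem setLIntegral_closedBall_le_maximalFunction_mul (F : E → ℝ≥0∞) (x : E) {r : ℝ} (hr : 0 < r) :
    ∫⁻ y in closedBall x r, F y ∂μ ≤ maximalFunction μ F x * μ (ball x r) := by
  rw [setLIntegral_congr (closedBall_ae_eq_ball_haar μ x hr)]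
  exact setLIntegral_ball_le_maximalFunction_mul μ F x hr

/-! ### Kernels with the decay `(1 + |y|)^{-n-1}` -/

omit [NormedSpace ℝ E] [FiniteDimensional ℝ E] [MeasurableSpace E] [BorelSpace E] in
/-- **Dyadic decomposition of the decay weight**: for `ε > 0` and every `z` there is `k` with
`z ∈ B(x, 2ᵏε)` and `(1 + |x-z|/ε)^{-(n+1)} ≤ 2ⁿ⁺¹ 2^{-(n+1)k}`. [folklore] -/
theorem exists_dyadic_shell (n : ℕ) (x z : E) {ε : ℝ} (hε : 0 < ε) :
    ∃ k : ℕ, z ∈ ball x (2 ^ k * ε) ∧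
      ((1 + ‖x - z‖ / ε) ^ (n + 1))⁻¹ ≤ (2 : ℝ) ^ (n + 1) * ((2 : ℝ) ^ ((n + 1) * k))⁻¹ := by
  set t : ℝ := ‖x - z‖ / ε with ht
  have ht0 : 0 ≤ t := by positivity
  have h1t : 1 ≤ 1 + t := by linarith
  -- `2^m ≤ 1 + t < 2^(m+1)`
  obtain ⟨m, hm1, hm2⟩ := exists_nat_pow_near h1t one_lt_two
  have key : ∀ j : ℕ, (((2 : ℝ) ^ j) ^ (n + 1))⁻¹ = (2 : ℝ) ^ (n + 1) * ((2 : ℝ) ^ ((n + 1) * (j + 1)))⁻¹ := by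
    intro j
    rw [eq_comm, mul_inv_eq_iff_eq_mul₀ (by positivity), ← pow_mul, inv_mul_eq_div,
      eq_div_iff (by positivity), ← pow_add]
    congr 1
    ring
  refine ⟨m + 1, ?_, ?_⟩
  · rw [mem_ball, dist_comm, dist_eq_norm]
    have htlt : t < 2 ^ (m + 1) := by linarith
    calc ‖x - z‖ = t * ε := by rw [ht, div_mul_cancel₀ _ hε.ne']
      _ < 2 ^ (m + 1) * ε := mul_lt_mul_of_pos_right htlt hε
  · have hpow : ((2 : ℝ) ^ m) ^ (n + 1) ≤ (1 + t) ^ (n + 1) := pow_le_pow_left₀ (by positivity) hm1 _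
    have hpos : (0 : ℝ) < ((2 : ℝ) ^ m) ^ (n + 1) := by positivity
    calc ((1 + t) ^ (n + 1))⁻¹ ≤ (((2 : ℝ) ^ m) ^ (n + 1))⁻¹ := inv_anti₀ hpos hpow
      _ = (2 : ℝ) ^ (n + 1) * ((2 : ℝ) ^ ((n + 1) * (m + 1)))⁻¹ := key m

/-- **Domination by the maximal function for kernels with the decay `(1+|y|)^{-n-1}`** (Stein
1970, Ch. III §2.2 Theorem 2 (a), the instance used for maximal singular integrals, §2 Lemma
(20)–(22)): for an a.e.-measurable size `F`, `ε > 0` and every `x`,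
`∫ F(z) (1 + |x-z|/ε)^{-(n+1)} dμ(z) ≤ 2ⁿ⁺² μ(B(x,ε)) MF(x)` (dyadic shells `B(x,2ᵏε)`,
`μ(B(x,2ᵏε)) = 2^{kn} μ(B(x,ε))`, `Σₖ 2^{-k} = 2`). [cite: Stein1971, Ch. III §2.2 Thm 2 (a)] -/
theorem lintegral_mul_decay_le_maximalFunction {F : E → ℝ≥0∞} (hF : AEMeasurable F μ) (x : E)
    {ε : ℝ} (hε : 0 < ε) :
    ∫⁻ z, F z * ENNReal.ofReal (((1 + ‖x - z‖ / ε) ^ (Module.finrank ℝ E + 1))⁻¹) ∂μ ≤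
      2 ^ (Module.finrank ℝ E + 2) * μ (ball x ε) * maximalFunction μ F x := by
  set n : ℕ := Module.finrank ℝ E with hn
  set M : ℝ≥0∞ := maximalFunction μ F x with hM
  -- the dyadic weights
  set a : ℕ → ℝ≥0∞ := fun k => (2 : ℝ≥0∞) ^ (n + 1) * ((2 : ℝ≥0∞) ^ ((n + 1) * k))⁻¹ with ha
  -- pointwise domination by the sum of the shell indicators
  have hpt : ∀ z, F z * ENNReal.ofReal (((1 + ‖x - z‖ / ε) ^ (n + 1))⁻¹) ≤
      ∑' k, (ball x (2 ^ k * ε)).indicator (fun z => a k * F z) z := by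
    intro z
    obtain ⟨k, hzk, hle⟩ := exists_dyadic_shell n x z hε
    calc F z * ENNReal.ofReal (((1 + ‖x - z‖ / ε) ^ (n + 1))⁻¹)
        ≤ F z * a k := by
          refine mul_le_mul' le_rfl ?_
          calc ENNReal.ofReal (((1 + ‖x - z‖ / ε) ^ (n + 1))⁻¹)
              ≤ ENNReal.ofReal ((2 : ℝ) ^ (n + 1) * ((2 : ℝ) ^ ((n + 1) * k))⁻¹) :=
                ENNReal.ofReal_le_ofReal hle
            _ = a k := by
                rw [ha, ENNReal.ofReal_mul (by positivity), ENNReal.ofReal_pow (by norm_num),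
                  ENNReal.ofReal_inv_of_pos (by positivity), ENNReal.ofReal_pow (by norm_num),
                  ENNReal.ofReal_ofNat]
      _ = (ball x (2 ^ k * ε)).indicator (fun z => a k * F z) z := by
          rw [indicator_of_mem hzk, mul_comm]
      _ ≤ ∑' k, (ball x (2 ^ k * ε)).indicator (fun z => a k * F z) z := ENNReal.le_tsum k
  -- integrate
  have hmeas : ∀ k, AEMeasurable ((ball x (2 ^ k * ε)).indicator fun z => a k * F z) μ :=
    fun k => (hF.const_mul _).indicator isOpen_ball.measurableSet
  have hshell : ∀ k : ℕ, ∫⁻ z, (ball x (2 ^ k * ε)).indicator (fun z => a k * F z) z ∂μ ≤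
      a k * (2 : ℝ≥0∞) ^ (n * k) * μ (ball x ε) * M := by
    intro k
    have h2k : (0 : ℝ) < 2 ^ k := by positivity
    rw [lintegral_indicator isOpen_ball.measurableSet, lintegral_const_mul'' _ hF.restrict]
    calc a k * ∫⁻ z in ball x (2 ^ k * ε), F z ∂μ ≤ a k * (M * μ (ball x (2 ^ k * ε))) :=
          mul_le_mul' le_rfl (setLIntegral_ball_le_maximalFunction_mul μ F x (by positivity))
      _ = a k * (2 : ℝ≥0∞) ^ (n * k) * μ (ball x ε) * M := by
          rw [measure_ball_mul_eq μ x x h2k ε, ← pow_mul, ENNReal.ofReal_pow (by norm_num),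
            ENNReal.ofReal_ofNat, mul_comm k n]
          ring
  -- the geometric series `Σ a_k 2^{nk} = 2^{n+1} Σ 2^{-k} = 2^{n+2}`
  have hgeom : ∑' k : ℕ, a k * (2 : ℝ≥0∞) ^ (n * k) = 2 ^ (n + 2) := by
    have hterm : ∀ k : ℕ, a k * (2 : ℝ≥0∞) ^ (n * k) = (2 : ℝ≥0∞) ^ (n + 1) * (2⁻¹) ^ k := by
      intro k
      simp only [ha]
      have h2 : (2 : ℝ≥0∞) ^ ((n + 1) * k) = (2 : ℝ≥0∞) ^ (n * k) * 2 ^ k := by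
        rw [← pow_add]; congr 1; ring
      have h3 : ((2 : ℝ≥0∞) ^ (n * k))⁻¹ * (2 : ℝ≥0∞) ^ (n * k) = 1 :=
        ENNReal.inv_mul_cancel (pow_ne_zero _ two_ne_zero) (ENNReal.pow_ne_top ENNReal.ofNat_ne_top)
      rw [h2, ENNReal.mul_inv (Or.inl (pow_ne_zero _ two_ne_zero)) (Or.inl (ENNReal.pow_ne_top ENNReal.ofNat_ne_top)),
        ← ENNReal.inv_pow]
      calc (2 : ℝ≥0∞) ^ (n + 1) * (((2 : ℝ≥0∞) ^ (n * k))⁻¹ * ((2 : ℝ≥0∞) ^ k)⁻¹) * 2 ^ (n * k)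
          = (2 : ℝ≥0∞) ^ (n + 1) * ((2 : ℝ≥0∞) ^ k)⁻¹ * (((2 : ℝ≥0∞) ^ (n * k))⁻¹ * (2 : ℝ≥0∞) ^ (n * k)) := by ring
        _ = (2 : ℝ≥0∞) ^ (n + 1) * ((2 : ℝ≥0∞) ^ k)⁻¹ := by rw [h3, mul_one]
    simp_rw [hterm]
    rw [ENNReal.tsum_mul_left, ENNReal.tsum_geometric, ENNReal.one_sub_inv_two, inv_inv]
    ring
  calc ∫⁻ z, F z * ENNReal.ofReal (((1 + ‖x - z‖ / ε) ^ (n + 1))⁻¹) ∂μ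
      ≤ ∫⁻ z, ∑' k, (ball x (2 ^ k * ε)).indicator (fun z => a k * F z) z ∂μ := lintegral_mono hpt
    _ = ∑' k, ∫⁻ z, (ball x (2 ^ k * ε)).indicator (fun z => a k * F z) z ∂μ := lintegral_tsum hmeas
    _ ≤ ∑' k, a k * (2 : ℝ≥0∞) ^ (n * k) * μ (ball x ε) * M := ENNReal.tsum_le_tsum hshell
    _ = (∑' k, a k * (2 : ℝ≥0∞) ^ (n * k)) * (μ (ball x ε) * M) := by
        rw [← ENNReal.tsum_mul_right]
        exact tsum_congr fun k => by ring
    _ = 2 ^ (n + 2) * μ (ball x ε) * M := by rw [hgeom, mul_assoc]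

/-! ### The maximal theorem in `eLpNorm` form -/

/-- **The maximal theorem in `eLpNorm` form, for functions** (Stein 1970, Ch. I §1.3 Theorem 1
(c)): for `1 < p < ∞` there is `C` (depending on `p` and `E`) with
`‖(M‖f‖)(·)‖_{L^p} ≤ C ‖f‖_{L^p}` for every a.e.-strongly measurable `f : E → G` (the maximal
function enters through its real part `(M‖f‖ₑ(x)).toReal`, `≤` the `[0,∞]` value everywhere).
[cite: Stein1971, Ch. I §1.3 Thm 1 (c)] -/
theorem exists_eLpNorm_maximalFunction_le {p : ℝ≥0∞} (hp1 : 1 < p) (hp2 : p < ⊤) :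
    ∃ C : ℝ≥0, ∀ {G : Type*} [NormedAddCommGroup G] (f : E → G), AEStronglyMeasurable f μ →
      eLpNorm (fun x => (maximalFunction μ (fun y => ‖f y‖ₑ) x).toReal) p μ ≤ C * eLpNorm f p μ := by
  have hp0 : p ≠ 0 := (zero_lt_one.trans hp1).ne'
  have hpt : p ≠ ⊤ := hp2.ne
  have hp' : 1 < p.toReal := by
    rw [← ENNReal.toReal_one]
    exact (ENNReal.toReal_lt_toReal ENNReal.one_ne_top hpt).2 hp1
  have hp0' : 0 < p.toReal := by linarith
  set C₀ : ℝ≥0∞ := ENNReal.ofReal p.toReal * (2 * 5 ^ Module.finrank ℝ E) *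
    ((2 : ℝ≥0∞) ^ (p.toReal - 1) / ENNReal.ofReal (p.toReal - 1)) with hC₀
  have hC₀t : C₀ ≠ ∞ := (maximalLpConst_lt_top _ hp').ne
  refine ⟨(C₀ ^ (1 / p.toReal)).toNNReal, fun {G} _ f hf => ?_⟩
  rw [ENNReal.coe_toNNReal (ENNReal.rpow_ne_top_of_nonneg (by positivity) hC₀t)]
  set M : E → ℝ≥0∞ := maximalFunction μ (fun y => ‖f y‖ₑ) with hM
  have hkey : ∫⁻ x, M x ^ p.toReal ∂μ ≤ C₀ * ∫⁻ y, ‖f y‖ₑ ^ p.toReal ∂μ :=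
    lintegral_maximalFunction_rpow_le μ hf.enorm hp'
  rw [eLpNorm_eq_lintegral_rpow_enorm_toReal hp0 hpt, eLpNorm_eq_lintegral_rpow_enorm_toReal hp0 hpt]
  have hle : ∫⁻ x, ‖(M x).toReal‖ₑ ^ p.toReal ∂μ ≤ ∫⁻ x, M x ^ p.toReal ∂μ := by
    refine lintegral_mono fun x => ENNReal.rpow_le_rpow ?_ hp0'.le
    rw [Real.enorm_eq_ofReal ENNReal.toReal_nonneg]
    exact ENNReal.ofReal_toReal_le
  calc (∫⁻ x, ‖(M x).toReal‖ₑ ^ p.toReal ∂μ) ^ (1 / p.toReal)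
      ≤ (C₀ * ∫⁻ y, ‖f y‖ₑ ^ p.toReal ∂μ) ^ (1 / p.toReal) :=
        ENNReal.rpow_le_rpow (hle.trans hkey) (by positivity)
    _ = C₀ ^ (1 / p.toReal) * (∫⁻ y, ‖f y‖ₑ ^ p.toReal ∂μ) ^ (1 / p.toReal) :=
        ENNReal.mul_rpow_of_nonneg _ _ (by positivity)

end Literature.Analysis.SingularIntegrals
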